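import Summits.BirchSwinnertonDyer.BirchSwinnertonDyer.Theorems.DerivedKatoValuationDoorIntegralH1RankLeTwoOfAnalyticRankTwoIffSelCapModPrint
import Summits.BirchSwinnertonDyer.BirchSwinnertonDyer.Theses.SelmerRank
import Summits.BirchSwinnertonDyer.BirchSwinnertonDyer.Theses.KatoTransfer
import Summits.BirchSwinnertonDyer.BirchSwinnertonDyer.Theses.PadicCornerSqueeze
import Literature.NumberTheory.EllipticCurves.BSDSelmer
import Literature.NumberTheory.EllipticCurves.BSDSelmerCMPConverseKLevelProofs
import HarnessLib

/-!
# Node edges of the research stub N1∣_door of the (β) crux S2 `IntegralH1RankLeTwoOfAnalyticRankTwo` (stmt-BirchSwinnertonDyer-23752):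
# the summit side, the lower-bound node, the one-prime node, and the CM vacuity (LEAD bsd-line-dkd-p1 g4; helper, closes nothing)

Companion to `…IntegralH1RankLeTwoOfAnalyticRankTwoTransfer.lean` (N1∣_door placed by name below `SelmerRankUB` 0130 / `SelmerRankRankTwo`
0129 / `PAdicOrderComparisonR2` 0489).  Here the remaining by-name edges of the node N1∣_door «`a = 2 ⇒ s_p ≤ 2` at door primes»:

* §1 SUMMIT SIDE (unconditional, by name): N1∣_door ⟸ the summit `BirchSwinnertonDyer` ∧ `SelmerRank.SelmerRankShaPFinite` (stmt-0132)
  (`selCapTwoAtDoor_of_summit_of_shaPFinite`; same three lines as the 0130 disprover's `selmerCorank_le_analyticRank_of_summit_of_shaPFinite`); so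
  N1∣_door is a CONSEQUENCE of the standard conjectures and a counterexample refutes BSD-rank at that curve or exhibits `corank Ш[p^∞] ≥ 2`
  at a big-image good ordinary prime (`analyticRank_ne_rank_or_two_le_shaCorank_of_failure_of_parity`, modulo `p`-parity) — it cannot be
  «refuted-misstated».
* §2 LOWER-BOUND NODE (unconditional in the two open items): N1∣_door ∧ `KatoTransfer.AnalyticRankLeSelmerCorank` (stmt-18412, `a ≤ s_p` at good
  ordinary `p ≥ 5`) ⇒ `s_p = 2` at every `a = 2` door cell (`selmerCorank_eq_two_of_selCapTwoAtDoor_of_analyticRankLeSelmerCorank`); cf. the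
  print version `selCapTwoAtDoor_iff_selmerCorank_eq_two_of_facts` of the Transfer file.
* §3 TRANSFER UP to the one-prime node: N1∣_door ⇒ the non-CM `a = 2` slice of `PadicCornerSqueeze.SelmerCapAtOnePrime` (stmt-19215, «`∃ p,
  s_p ≤ a`»): a door prime exists for every non-CM curve (Serre's open image theorem + infinitely many good ordinary primes, tree theorems)
  (`exists_selmerCorank_le_analyticRank_of_selCapTwoAtDoor`).
* §4 CM VACUITY (unconditional): a CM curve has no door prime (`not_hasCM_of_hasSurjectiveModNGaloisRep_of_five_le`, Serre 1972 §4.5), so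
  N1∣_door is equivalent to its restriction to non-CM curves (`selCapTwoAtDoor_iff_nonCM`) — the CM Tate face is the separate item `TateTwoCM`.

Nothing here proves N1∣_door, S2, any SelmerRank / KatoTransfer / PadicCornerSqueeze item, or BSD.  Helper for stmt-BirchSwinnertonDyer-23752.

References: [cite: GreenbergLNM1716, §1 (p. 63)]; [cite: DokchitserDokchitserAnnals2010, Thm. 1.4]; [cite: Serre1972, §4.4 Thm. 2 and §4.5];
[cite: Kato2004Asterisque, Thm. 18.4 (p. 281)].
-/

set_option linter.dupNamespace false
set_option autoImplicit false

noncomputable section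

open scoped Classical

namespace Summit.BirchSwinnertonDyer.BirchSwinnertonDyer.Theorems.DerivedKatoValuationDoor

open Literature Literature.NumberTheory.EllipticCurves
open Summit.BirchSwinnertonDyer.BirchSwinnertonDyer.Theses.SelmerRank (SelmerRankUB SelmerRankShaPFinite)
open Summit.BirchSwinnertonDyer.BirchSwinnertonDyer.Theses.KatoTransfer (AnalyticRankLeSelmerCorank)
open Summit.BirchSwinnertonDyer.BirchSwinnertonDyer.Theses.PadicCornerSqueeze (SelmerCapAtOnePrime)

/-! ## §1 The summit side -/

/-- **N1∣_door ⟸ BSD-rank ∧ Ш[p^∞]-finiteness, BY NAME (unconditional)**: the Lean summit `BirchSwinnertonDyer` (`a = r` for every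
elliptic `W/ℚ`) together with the SelmerRank crux `SelmerRankShaPFinite` (stmt-0132: `Ш(W/ℚ)[p^∞]` finite for all `(W, p)`) gives
`s_p = r + corank Ш[p^∞] = a + 0` everywhere (Greenberg's identity, tree theorem), hence N1∣_door.  So the research stub is implied by the standard conjectures; neither
hypothesis is proved. [cite: GreenbergLNM1716, §1 (p. 63)] -/
theorem selCapTwoAtDoor_of_summit_of_shaPFinite (hS : _root_.BirchSwinnertonDyer) (hSha : SelmerRankShaPFinite) :
    ∀ (W : WeierstrassCurve ℚ) [W.IsElliptic] [W.IsGloballyMinimal] (p : ℕ) [Fact p.Prime],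
      W.analyticRank = 2 →
        (5 ≤ p ∧ Literature.NumberTheory.EllipticCurves.IsOrdinaryAt W p ∧ W.HasSurjectiveModNGaloisRep p) →
          W.selmerCorank p ≤ 2 := by
  intro W _ _ p _ ha _
  have h0 : W.analyticRank = W.mordellWeilRank := hS W inferInstance
  have h2 : W.selmerCorank p = W.mordellWeilRank + W.shaCorank p :=
    W.selmerCorank_eq_mordellWeilRank_add_holds p
  have h3 : W.shaCorank p = 0 := Literature.BSD.shaCorank_eq_zero_of_finite W p (hSha W p)
  omega

/-- **Shape of a failure against the conjectures** (modulo `p`-parity `selmerCorank_mod_two_eq W p`): if N1∣_door fails at an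
analytic-rank-two `W` and a prime `p`, then either BSD-rank fails AT `W` (`a ≠ r`, indeed `r ≥ 3`) or `Ш(W)[p^∞]` has corank `≥ 2` —
because the failure has `s_p ≥ 4 = r + corank Ш[p^∞]` (Greenberg's identity).  CONDITIONAL on the parity fact.
[cite: DokchitserDokchitserAnnals2010, Thm. 1.4] [cite: GreenbergLNM1716, §1 (p. 53)] -/
theorem analyticRank_ne_rank_or_two_le_shaCorank_of_failure_of_parity (W : WeierstrassCurve ℚ) [W.IsElliptic]
    (p : ℕ) [Fact p.Prime] (hpar : selmerCorank_mod_two_eq W p) (ha : W.analyticRank = 2)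
    (hfail : ¬ W.selmerCorank p ≤ 2) : W.analyticRank ≠ W.mordellWeilRank ∨ 2 ≤ W.shaCorank p := by
  have hp : W.selmerCorank p % 2 = W.analyticRank % 2 := hpar
  rw [ha] at hp
  have h4 : 4 ≤ W.selmerCorank p := by omega
  have hid := W.selmerCorank_eq_mordellWeilRank_add_holds p
  by_cases hr : W.mordellWeilRank ≤ 2
  · right; omega
  · left; omega

/-! ## §2 With the lower-bound node: `s_p = 2` exactly -/

/-- **N1∣_door ∧ `AnalyticRankLeSelmerCorank` (stmt-18412) ⇒ `s_p = 2` at every `a = 2` door cell**, unconditionally in the two open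
items (18412 is «`a ≤ s_p` at good ordinary `p ≥ 5`», the ≤ half of the rank-`r` `p`-converse; at `a = 2` it is print modulo
{modularity, BCS 1.1.2 (a), parity}, cf. `two_le_selmerCorank_of_analyticRankTwo_of_door_of_facts`). [cite: Kato2004Asterisque, Thm. 18.4 (p. 281)] -/
theorem selmerCorank_eq_two_of_selCapTwoAtDoor_of_analyticRankLeSelmerCorank
    (hN1 : ∀ (W : WeierstrassCurve ℚ) [W.IsElliptic] [W.IsGloballyMinimal] (p : ℕ) [Fact p.Prime],
      W.analyticRank = 2 →
        (5 ≤ p ∧ Literature.NumberTheory.EllipticCurves.IsOrdinaryAt W p ∧ W.HasSurjectiveModNGaloisRep p) →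
          W.selmerCorank p ≤ 2)
    (hLB : AnalyticRankLeSelmerCorank)
    (W : WeierstrassCurve ℚ) [W.IsElliptic] [W.IsGloballyMinimal] (p : ℕ) [Fact p.Prime] (ha : W.analyticRank = 2)
    (hdoor : 5 ≤ p ∧ Literature.NumberTheory.EllipticCurves.IsOrdinaryAt W p ∧ W.HasSurjectiveModNGaloisRep p) :
    W.selmerCorank p = 2 := by
  have hle := hN1 W p ha hdoor
  obtain ⟨h5, hord, _⟩ := hdoor
  have hgo := (isOrdinaryAt_iff W p).1 hord
  have hge := hLB W p h5 hgo.1 hgo.2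
  omega

/-! ## §3 Transfer up to the one-prime node `SelmerCapAtOnePrime` (non-CM `a = 2` slice) -/

/-- **N1∣_door ⇒ the non-CM analytic-rank-two slice of `SelmerCapAtOnePrime` (stmt-19215)**: for a globally minimal NON-CM `W/ℚ` with
`a = 2` there is a prime `p` with `s_p ≤ a` — take any door prime (Serre's open image theorem `serre_open_image_holds` + infinitely many good
ordinary primes `infinite_goodOrdinaryPrimes_holds`, both tree theorems).  Unconditional in the open hypothesis N1∣_door; the CM curves and
`a ≥ 3` of 19215 are not touched. [cite: Serre1972, §4.4 Thm. 2] -/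
theorem exists_selmerCorank_le_analyticRank_of_selCapTwoAtDoor
    (hN1 : ∀ (W : WeierstrassCurve ℚ) [W.IsElliptic] [W.IsGloballyMinimal] (p : ℕ) [Fact p.Prime],
      W.analyticRank = 2 →
        (5 ≤ p ∧ Literature.NumberTheory.EllipticCurves.IsOrdinaryAt W p ∧ W.HasSurjectiveModNGaloisRep p) →
          W.selmerCorank p ≤ 2)
    (W : WeierstrassCurve ℚ) [W.IsElliptic] [W.IsGloballyMinimal] (hcm : ¬ W.HasCM) (ha : W.analyticRank = 2) :
    ∃ (p : ℕ) (_ : Fact p.Prime), W.selmerCorank p ≤ W.analyticRank := by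
  obtain ⟨p₀, hp₀⟩ := Literature.NumberTheory.EllipticCurves.serre_open_image_holds W hcm
  obtain ⟨p, ⟨hp, hgood, hord⟩, hlt⟩ :=
    (WeierstrassCurve.infinite_goodOrdinaryPrimes_holds W).exists_gt (max p₀ 4)
  haveI : Fact p.Prime := hp
  have h5 : 5 ≤ p := by have := le_max_right p₀ 4; omega
  have hle : p₀ ≤ p := by have := le_max_left p₀ 4; omega
  have hdoor : 5 ≤ p ∧ Literature.NumberTheory.EllipticCurves.IsOrdinaryAt W p ∧ W.HasSurjectiveModNGaloisRep p :=
    ⟨h5, (Literature.NumberTheory.EllipticCurves.isOrdinaryAt_iff W p).2 ⟨hgood, hord⟩, hp₀ p hp.out hle⟩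
  refine ⟨p, hp, ?_⟩
  rw [ha]
  exact hN1 W p ha hdoor

/-- **The whole `a = 2` slice of `SelmerCapAtOnePrime` from N1∣_door and its CM companion** (CM curves: any prime with `s_p ≤ a`, e.g. from
the CM item `SelmerRank.SelmerRankCM`-type input, here taken as the spelled-out hypothesis `hCM`).  Unconditional in the two hypotheses. [folklore] -/
theorem exists_selmerCorank_le_analyticRank_of_selCapTwoAtDoor_of_cm
    (hN1 : ∀ (W : WeierstrassCurve ℚ) [W.IsElliptic] [W.IsGloballyMinimal] (p : ℕ) [Fact p.Prime],
      W.analyticRank = 2 →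
        (5 ≤ p ∧ Literature.NumberTheory.EllipticCurves.IsOrdinaryAt W p ∧ W.HasSurjectiveModNGaloisRep p) →
          W.selmerCorank p ≤ 2)
    (hCM : ∀ (W : WeierstrassCurve ℚ) [W.IsElliptic] [W.IsGloballyMinimal], W.HasCM → W.analyticRank = 2 →
      ∃ (p : ℕ) (_ : Fact p.Prime), W.selmerCorank p ≤ W.analyticRank)
    (W : WeierstrassCurve ℚ) [W.IsElliptic] [W.IsGloballyMinimal] (ha : W.analyticRank = 2) :
    ∃ (p : ℕ) (_ : Fact p.Prime), W.selmerCorank p ≤ W.analyticRank := by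
  by_cases hcm : W.HasCM
  · exact hCM W hcm ha
  · exact exists_selmerCorank_le_analyticRank_of_selCapTwoAtDoor hN1 W hcm ha

/-! ## §4 CM vacuity: N1∣_door binds no CM curve -/

/-- **N1∣_door ⟺ its restriction to non-CM curves**: a curve with a door prime (`p ≥ 5` good ordinary with `ρ̄_{E,p}` onto) has no CM
(`not_hasCM_of_hasSurjectiveModNGaloisRep_of_five_le`, Serre 1972 §4.5), so the CM sector of the Tate face is the separate item `TateTwoCM`
and N1∣_door says nothing there.  Unconditional. [cite: Serre1972, §4.5] -/
theorem selCapTwoAtDoor_iff_nonCM :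
    (∀ (W : WeierstrassCurve ℚ) [W.IsElliptic] [W.IsGloballyMinimal] (p : ℕ) [Fact p.Prime],
      W.analyticRank = 2 →
        (5 ≤ p ∧ Literature.NumberTheory.EllipticCurves.IsOrdinaryAt W p ∧ W.HasSurjectiveModNGaloisRep p) →
          W.selmerCorank p ≤ 2) ↔
    ∀ (W : WeierstrassCurve ℚ) [W.IsElliptic] [W.IsGloballyMinimal] (p : ℕ) [Fact p.Prime], ¬ W.HasCM →
      W.analyticRank = 2 →
        (5 ≤ p ∧ Literature.NumberTheory.EllipticCurves.IsOrdinaryAt W p ∧ W.HasSurjectiveModNGaloisRep p) →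
          W.selmerCorank p ≤ 2 := by
  constructor
  · intro h W _ _ p _ _ ha hdoor
    exact h W p ha hdoor
  · intro h W _ _ p _ ha hdoor
    obtain ⟨h5, hord, hsurj⟩ := hdoor
    have hgo := (isOrdinaryAt_iff W p).1 hord
    have hcm : ¬ W.HasCM := not_hasCM_of_hasSurjectiveModNGaloisRep_of_five_le W p h5 hgo.1 hgo.2 hsurj
    exact h W p hcm ha ⟨h5, hord, hsurj⟩

end Summit.BirchSwinnertonDyer.BirchSwinnertonDyer.Theorems.DerivedKatoValuationDoor

end
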